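import Literature.NumberTheory.LFunctions.WeilMarkovQuadratic
import HarnessLib

/-!
# The window form of Weil's functional on `[-a, a]`

Normalisation of `Literature/NumberTheory/LFunctions/WeilExplicit.lean` and `WeilMarkovQuadratic.lean`
(`Q(g) = weilQuadratic g = W(g ⋆ g̃)`; Markov decomposition `Re Q(g) = P(g) + 𝓔_a(g) − M_a‖g‖₂²` for
test functions supported in `[-a, a]`, Bombieri 2000 Thm. 2 read through increments).

* `weilWindowForm a u := P(u) + 𝓔_a(u) − M_a ‖u‖₂²` (`P = weilPoleForm`, `𝓔_a = weilDirichletEnergy a`,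
  `M_a = weilMarkovConstant a`): defined for EVERY `u : ℝ → ℂ` (all ingredients are Bochner
  integrals) — in particular on Yoshida's space `K(a) ⊃ C(a)` of `2a`-periodic smooth functions
  restricted to the closed window (jumps at `±a`) and on the trigonometric windows `Σ c_n χ_n` on
  which Fourier–Galerkin certificates ("format C") evaluate the form;
* `weilWindowForm_eq_re_weilQuadratic`: `weilWindowForm a g = Re Q(g)` for test functions supported in
  `[-a, a]`.

Consumers: `Summits/RiemannHypothesis/RiemannHypothesis/Theorems/WeilFormatCWindowFamily.lean`
(continuity of the window form along uniformly convergent window families) and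
`…/WeilFormatCWindowDictionary.lean` (positivity on the trigonometric windows ⟹ `WeilPositivityOn a`).

## References

* E. Bombieri, *Remarks on Weil's quadratic functional in the theory of prime numbers I*,
  Rend. Mat. Acc. Lincei (9) 11 (2000), Thm. 2 (p. 193).
* H. Yoshida, *On Hermitian forms attached to zeta functions*, Adv. Stud. Pure Math. 21 (1992), §2–3.
-/

set_option autoImplicit false

noncomputable section

open Complex Filter Set MeasureTheory
open scoped Real Topology ComplexConjugate

namespace Literature.NumberTheory.LFunctions

open _root_.MeasureTheory _root_.Topology

/-! ## §1 The window form -/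

/-- The **window form** of `[-a, a]`: `P(u) + 𝓔_a(u) − M_a ‖u‖₂²`, with `P = weilPoleForm` the pole
form, `𝓔_a = weilDirichletEnergy a` the pure-jump Dirichlet energy (prime jumps `log n < 2a` and the
archimedean jump density `e^{t/2}/(2 sinh t)`) and `M_a = weilMarkovConstant a` the killing
constant. Defined for every `u : ℝ → ℂ`; equal to `Re Q(u)` for test functions supported in
`[-a, a]` (`weilWindowForm_eq_re_weilQuadratic`). This is the form a Fourier–Galerkin certificate
on the window evaluates on the trigonometric windows `Σ c_n χ_n`.
[cite: Bombieri2000Weil, Thm 2 (p. 193)] -/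
def weilWindowForm (a : ℝ) (u : ℝ → ℂ) : ℝ :=
  weilPoleForm u + weilDirichletEnergy a u - weilMarkovConstant a * ∫ x : ℝ, ‖u x‖ ^ 2

/-- For a test function supported in `[-a, a]` the window form IS `Re Q(g)`
(the Markov decomposition `weilQuadratic_re_eq_weilPoleForm_add_weilDirichletEnergy_sub`).
[cite: Bombieri2000Weil, Thm 2 (p. 193)] -/
theorem weilWindowForm_eq_re_weilQuadratic {g : ℝ → ℂ} (hg : IsWeilTest g) {a : ℝ}
    (hsupp : tsupport g ⊆ Icc (-a) a) : weilWindowForm a g = (weilQuadratic g).re := by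
  rw [weilWindowForm, weilQuadratic_re_eq_weilPoleForm_add_weilDirichletEnergy_sub hg hsupp]

end Literature.NumberTheory.LFunctions

end
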